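import Mathlib.Analysis.InnerProductSpace.Basic
import Mathlib.Analysis.InnerProductSpace.LinearMap
import Mathlib.Analysis.InnerProductSpace.Calculus
import Mathlib.Analysis.SpecialFunctions.Sqrt
import Mathlib.Analysis.SpecialFunctions.Pow.Real
import Mathlib.LinearAlgebra.Determinant
import Mathlib.Topology.Algebra.Module.Determinant
import Mathlib.Topology.Algebra.Module.FiniteDimension
import Mathlib.MeasureTheory.Function.Jacobian
import HarnessLib

/-!
# The hard-sphere billiard: pair kinematics and Liouville's theorem for one binary collision

First layer of the construction of the hard-sphere flow (Alexander's theorem,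
`Literature.Analysis.FluidPDE.HardSphereFlow.nonempty` in `Literature.Analysis.FluidPDE.HardSphereDynamics`;
Cercignani–Illner–Pulvirenti 1994 §4.2 Thm 4.2.1 and App. 4.A; Gallagher–Saint-Raymond–Texier
2013 Prop. 4.1.1). Everything here concerns *two* particles, i.e. the relative motion
`(q, w) = (x₁ - x₂, v₁ - v₂)` in a real inner product space `E`, which between collisions is the
free line `t ↦ q + t w` and at contact `‖q‖ = ε` reflects `w` in the hyperplane `qᗮ` — the
billiard in the exterior of the ball of radius `ε`.

* `Kinetic.pairDisc`, `Kinetic.PairHits`, `Kinetic.pairHitTime`: the quadratic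
  `‖q + t w‖² - ε²`, whether/when the pair first reaches distance `ε` while approaching, with the
  kinematic facts the `N`-body construction needs: the distance is `> ε` before the hitting time
  and `= ε` at it, the pair is then incoming-or-grazing (`⟪n, w⟫ = -√disc`), a non-hitting pair
  stays at distance `> ε` forever, equivariance `τ(q + s w, w) = τ(q, w) - s`.
* `Kinetic.reflN ε n`: the reflection `w ↦ w - (2⟪n, w⟫/ε²) n` of relative velocities
  (GST 2013 (1.1.3)) as a continuous linear map; involutive, isometric, `(det)² = 1`.
* `Kinetic.billiardMap ε = S_{-τ} ∘ C ∘ S_τ : (q, w) ↦ (n - τ w', w')` on the open good set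
  `Kinetic.billiardGood ε` (strictly outside, approaching, non-grazing): differentiable with an
  explicit derivative `Kinetic.dBilliard` which factors as
  shear ∘ (`R_n × id`) ∘ shear ∘ (`id × R_n`) ∘ shear, hence **`det = 1`**
  (`Kinetic.det_dBilliard`); injective; therefore, by the change-of-variables formula
  (`MeasureTheory.lintegral_abs_det_fderiv_eq_addHaar_image`), **volume preserving**:
  `Kinetic.addHaar_image_billiardMap`. This is the measure-theoretic input ("the collision
  transformation preserves Lebesgue measure", CIP 1994 §4.2 p.65 and Problem 1 p.68; "by the
  Liouville theorem", App. 4.A pp.107–109) that GST 2013 use in the proof of Prop. 4.1.1 in the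
  form "since the measure is invariant by the flow".
* `Kinetic.twoBodyCollide ε`: the same step in particle coordinates
  `((x₁, v₁), (x₂, v₂)) ↦ ((x₁ + τ c n, v₁ - c n), (x₂ - τ c n, v₂ + c n))`, `c = ⟪n, v₁ - v₂⟫/ε²`,
  shown to be the conjugate of `id × billiardMap` by the centre/relative coordinates
  `Kinetic.sumDiffEquiv`; hence differentiable with `det = 1`, injective and volume preserving on
  `Kinetic.twoBodyGood ε` (`Kinetic.addHaar_image_twoBodyCollide`).
* Shears `Kinetic.upperShear`/`Kinetic.lowerShear` on `E × F` have determinant `1`, proved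
  without matrices or bases (`det U_T · det U_{-T} = 1`, `U_{-T}` conjugate to `U_T`,
  `U_T = U_{T/2}²`).

## Mathlib / Literature reuse

`LinearMap.det`, `ContinuousLinearMap.det`, `LinearMap.det_prodMap`, `LinearMap.det_conj`,
`HasFDerivAt.norm_sq`, `HasFDerivAt.inner`, `HasFDerivAt.unique` (implicit differentiation of
the hitting time), `MeasureTheory.lintegral_abs_det_fderiv_eq_addHaar_image` and
`MeasureTheory.measurable_image_of_fderivWithin` are Mathlib's. Mathlib has no billiard map and no
determinant lemma for block-triangular continuous linear maps on `E × F` (grep `billiard`,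
`skewProd.*det`: nothing). The `N`-particle notions (`Kinetic.freeFlight`, `Kinetic.collidePair`,
`Kinetic.reflectVel`) live in `Literature.Analysis.FluidPDE.HardSpherePhaseSpace`; this file is
deliberately independent of them (pure two-body geometry in an abstract inner product space) and
the identification `v_i' - v_j' = reflN ε (x_i - x_j) (v_i - v_j)` at contact is immediate from
`Kinetic.reflectVel`.

## Design choices

* `pairHitTime` is a total real-valued function (the root formula); its value is meaningful only
  under `PairHits`. Grazing contact (`pairDisc = 0`) counts as a hit (it is a contact time of the
  trajectory) but is excluded from `billiardGood`.
* `billiardMap` flows *back* by `τ` after the collision, so that the physical one-step dynamics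
  over a window `[0, δ]`, `δ ≥ τ`, is `S_δ ∘ billiardMap` with the *linear* volume-preserving free
  flight `S_δ` (`billiardMap_fst_add_smul`); the intermediate point `n - τ w'` may lie inside the
  ball, which is harmless.
* Measure statements are for an arbitrary additive Haar measure on `E × E` (resp.
  `(E × E) × (E × E)`), `E` finite-dimensional; for `E = EuclideanSpace ℝ d` and `volume` use
  `MeasureTheory.Measure.prod.instIsAddHaarMeasure`.

## References

* C. Cercignani, R. Illner, M. Pulvirenti, *The Mathematical Theory of Dilute Gases*, Springer
  (1994), §4.2 pp.64–68 (collision transformation `J`, Thm 4.2.1, Problem 1), Appendix 4.A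
  pp.107–111 (special flow representation, Liouville).
* I. Gallagher, L. Saint-Raymond, B. Texier, *From Newton to Boltzmann: hard spheres and
  short-range potentials*, EMS (2013), arXiv:1208.5753, §4.1 (1.1.1)–(1.1.3), Prop. 4.1.1,
  Lemma 4.1.2.
* R. K. Alexander, *The infinite hard sphere system*, Ph.D. thesis, UC Berkeley (1975);
  R. Alexander, *Time evolution for infinitely many hard spheres*, Comm. Math. Phys. 49 (1976).
-/

open Real Set MeasureTheory Filter Topology
open scoped InnerProductSpace

namespace Literature.Analysis.FluidPDE

noncomputable section

section Kinetic


/-! ## Pair kinematics: the first hitting time of the relative free motion -/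

section Pair

variable {E : Type*} [NormedAddCommGroup E] [InnerProductSpace ℝ E]

/-- The quarter-discriminant `⟪q, w⟫² - ‖w‖² (‖q‖² - ε²)` of the quadratic
`t ↦ ‖q + t w‖² - ε²` describing the distance of two freely moving particles with relative
position `q` and relative velocity `w` (CIP 1994 §4.2; GST 2013 §4.1). [folklore] -/
def pairDisc (ε : ℝ) (q w : E) : ℝ := ⟪q, w⟫_ℝ ^ 2 - ‖w‖ ^ 2 * (‖q‖ ^ 2 - ε ^ 2)

/-- The relative free motion `t ↦ q + t w` reaches distance `ε` at some time `t ≥ 0` while the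
pair is approaching: `⟪q, w⟫ < 0` and the line meets the closed ball of radius `ε`
(grazing contact, `pairDisc = 0`, is included). [folklore] -/
def PairHits (ε : ℝ) (q w : E) : Prop := ⟪q, w⟫_ℝ < 0 ∧ 0 ≤ pairDisc ε q w

/-- The first hitting time `τ = (-⟪q, w⟫ - √disc) / ‖w‖²` of the relative free motion with the
sphere of radius `ε` (the smaller root of `‖q + t w‖² = ε²`); a junk real number when
`¬ PairHits ε q w`. [folklore] -/
def pairHitTime (ε : ℝ) (q w : E) : ℝ :=
  (-⟪q, w⟫_ℝ - Real.sqrt (pairDisc ε q w)) / ‖w‖ ^ 2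

/-- Expansion of `‖q + t w‖²`. [folklore] -/
theorem norm_add_smul_sq (q w : E) (t : ℝ) :
    ‖q + t • w‖ ^ 2 = ‖q‖ ^ 2 + 2 * t * ⟪q, w⟫_ℝ + t ^ 2 * ‖w‖ ^ 2 := by
  rw [norm_add_sq_real, real_inner_smul_right, norm_smul, mul_pow, Real.norm_eq_abs, sq_abs]
  ring

/-- `‖q + t w‖² - ε²` as a quadratic polynomial in `t`. [folklore] -/
theorem norm_add_smul_sq_sub (ε : ℝ) (q w : E) (t : ℝ) :
    ‖q + t • w‖ ^ 2 - ε ^ 2 =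
      ‖w‖ ^ 2 * t ^ 2 + 2 * ⟪q, w⟫_ℝ * t + (‖q‖ ^ 2 - ε ^ 2) := by
  rw [norm_add_smul_sq]; ring

/-- The discriminant is invariant under free flight. [folklore] -/
@[simp] theorem pairDisc_add_smul (ε : ℝ) (q w : E) (s : ℝ) :
    pairDisc ε (q + s • w) w = pairDisc ε q w := by
  simp only [pairDisc, inner_add_left, real_inner_smul_left, real_inner_self_eq_norm_sq,
    norm_add_smul_sq]
  ring

/-- `⟪q + s w, w⟫ = ⟪q, w⟫ + s ‖w‖²`. [folklore] -/
theorem inner_add_smul_self (q w : E) (s : ℝ) :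
    ⟪q + s • w, w⟫_ℝ = ⟪q, w⟫_ℝ + s * ‖w‖ ^ 2 := by
  rw [inner_add_left, real_inner_smul_left, real_inner_self_eq_norm_sq]

/-- Algebra: the smaller root annihilates the quadratic (`a = ‖w‖², b = ⟪q,w⟫, c = ‖q‖² - ε²,
s = √disc`). [folklore] -/
private theorem alg_root (a b c s : ℝ) (ha : a ≠ 0) (hs2 : s ^ 2 = b ^ 2 - a * c) :
    a * ((-b - s) / a) ^ 2 + 2 * b * ((-b - s) / a) + c = 0 := by
  field_simp
  linear_combination hs2

/-- Algebra: `b + τ a = -s`. [folklore] -/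
private theorem alg_inner (a b s : ℝ) (ha : a ≠ 0) : b + (-b - s) / a * a = -s := by
  field_simp; ring

/-- Algebra: factorisation of the quadratic by its two roots. [folklore] -/
private theorem alg_factor (a b c s t : ℝ) (ha : a ≠ 0) (hs2 : s ^ 2 = b ^ 2 - a * c) :
    a * t ^ 2 + 2 * b * t + c = a * ((-b - s) / a - t) * ((-b + s) / a - t) := by
  field_simp
  linear_combination hs2

/-- Algebra: completing the square. [folklore] -/
private theorem alg_square (a b c t : ℝ) (ha : a ≠ 0) :
    a * t ^ 2 + 2 * b * t + c = a * (t + b / a) ^ 2 + (a * c - b ^ 2) / a := by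
  field_simp
  ring

/-- The hitting time is equivariant under free flight: `τ(q + s w, w) = τ(q, w) - s`. [folklore] -/
theorem pairHitTime_add_smul (ε : ℝ) (q w : E) (hw : w ≠ 0) (s : ℝ) :
    pairHitTime ε (q + s • w) w = pairHitTime ε q w - s := by
  have hw' : ‖w‖ ^ 2 ≠ 0 := pow_ne_zero 2 (norm_ne_zero_iff.2 hw)
  rw [pairHitTime, pairHitTime, pairDisc_add_smul, inner_add_smul_self]
  generalize ‖w‖ ^ 2 = a at hw' ⊢
  field_simp
  ring

/-- An approaching pair has nonzero relative velocity. [folklore] -/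
theorem PairHits.norm_pos {ε : ℝ} {q w : E} (h : PairHits ε q w) : 0 < ‖w‖ := by
  rcases h with ⟨h1, -⟩
  refine norm_pos_iff.2 ?_
  rintro rfl
  simp at h1

/-- Outside the ball, `disc ≤ ⟪q, w⟫²`. [folklore] -/
theorem pairDisc_le_inner_sq {ε : ℝ} {q w : E} (hε : 0 ≤ ε) (hq : ε ≤ ‖q‖) :
    pairDisc ε q w ≤ ⟪q, w⟫_ℝ ^ 2 := by
  have : 0 ≤ ‖w‖ ^ 2 * (‖q‖ ^ 2 - ε ^ 2) :=
    mul_nonneg (sq_nonneg _) (sub_nonneg.2 (pow_le_pow_left₀ hε hq 2))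
  unfold pairDisc; linarith

/-- Outside the ball and approaching, `√disc ≤ -⟪q, w⟫`. [folklore] -/
theorem sqrt_pairDisc_le {ε : ℝ} {q w : E} (hε : 0 ≤ ε) (hq : ε ≤ ‖q‖) (hb : ⟪q, w⟫_ℝ < 0) :
    Real.sqrt (pairDisc ε q w) ≤ -⟪q, w⟫_ℝ := by
  rw [← Real.sqrt_sq (by linarith : 0 ≤ -⟪q, w⟫_ℝ), neg_sq]
  exact Real.sqrt_le_sqrt (pairDisc_le_inner_sq hε hq)

/-- Outside the ball and approaching, the hitting time is nonnegative. [folklore] -/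
theorem pairHitTime_nonneg {ε : ℝ} {q w : E} (hε : 0 ≤ ε) (hq : ε ≤ ‖q‖) (hb : ⟪q, w⟫_ℝ < 0) :
    0 ≤ pairHitTime ε q w :=
  div_nonneg (by linarith [sqrt_pairDisc_le (w := w) hε hq hb]) (sq_nonneg _)

/-- The defining equation: at the hitting time the distance is `ε`. [folklore] -/
theorem norm_add_pairHitTime_smul {ε : ℝ} {q w : E} (hε : 0 ≤ ε) (h : PairHits ε q w) :
    ‖q + pairHitTime ε q w • w‖ = ε := by
  have ha : ‖w‖ ^ 2 ≠ 0 := (pow_pos h.norm_pos 2).ne'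
  have hs2 : Real.sqrt (pairDisc ε q w) ^ 2 = ⟪q, w⟫_ℝ ^ 2 - ‖w‖ ^ 2 * (‖q‖ ^ 2 - ε ^ 2) :=
    Real.sq_sqrt h.2
  have key : ‖q + pairHitTime ε q w • w‖ ^ 2 - ε ^ 2 = 0 := by
    rw [norm_add_smul_sq_sub, pairHitTime]
    exact alg_root _ _ _ _ ha hs2
  have h2 : ‖q + pairHitTime ε q w • w‖ ^ 2 = ε ^ 2 := by linarith
  exact (sq_eq_sq₀ (norm_nonneg _) hε).1 h2

/-- At the hitting time the pair is incoming or grazing: `⟪n, w⟫ = -√disc ≤ 0`. [folklore] -/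
theorem inner_add_pairHitTime_smul {ε : ℝ} {q w : E} (h : PairHits ε q w) :
    ⟪q + pairHitTime ε q w • w, w⟫_ℝ = -Real.sqrt (pairDisc ε q w) := by
  have ha : ‖w‖ ^ 2 ≠ 0 := (pow_pos h.norm_pos 2).ne'
  rw [inner_add_smul_self, pairHitTime]
  exact alg_inner _ _ _ ha

/-- Before the hitting time the distance is `> ε` (the hitting time is the *first* contact).
[folklore] -/
theorem lt_norm_add_smul_of_lt_pairHitTime {ε : ℝ} {q w : E} (h : PairHits ε q w)
    {t : ℝ} (ht : t < pairHitTime ε q w) : ε < ‖q + t • w‖ := by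
  have ha : 0 < ‖w‖ ^ 2 := pow_pos h.norm_pos 2
  set s := Real.sqrt (pairDisc ε q w) with hs
  have hs0 : 0 ≤ s := Real.sqrt_nonneg _
  have hs2 : s ^ 2 = ⟪q, w⟫_ℝ ^ 2 - ‖w‖ ^ 2 * (‖q‖ ^ 2 - ε ^ 2) := Real.sq_sqrt h.2
  have key : ‖q + t • w‖ ^ 2 - ε ^ 2 =
      ‖w‖ ^ 2 * ((-⟪q, w⟫_ℝ - s) / ‖w‖ ^ 2 - t) * ((-⟪q, w⟫_ℝ + s) / ‖w‖ ^ 2 - t) := by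
    rw [norm_add_smul_sq_sub]
    exact alg_factor _ _ _ _ _ ha.ne' hs2
  have h1 : 0 < (-⟪q, w⟫_ℝ - s) / ‖w‖ ^ 2 - t := by
    have : pairHitTime ε q w = (-⟪q, w⟫_ℝ - s) / ‖w‖ ^ 2 := rfl
    linarith
  have h2 : 0 < (-⟪q, w⟫_ℝ + s) / ‖w‖ ^ 2 - t := by
    have : (-⟪q, w⟫_ℝ - s) / ‖w‖ ^ 2 ≤ (-⟪q, w⟫_ℝ + s) / ‖w‖ ^ 2 :=
      div_le_div_of_nonneg_right (by linarith) ha.le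
    linarith
  have hpos : 0 < ‖q + t • w‖ ^ 2 - ε ^ 2 := by
    rw [key]; positivity
  have : ε ^ 2 < ‖q + t • w‖ ^ 2 := by linarith
  exact lt_of_pow_lt_pow_left₀ 2 (norm_nonneg _) this

/-- If the pair does not hit, the distance stays `> ε` for all `t > 0`, unless the pair is in the
degenerate permanent contact `‖q‖ = ε, w = 0`. [folklore] -/
theorem lt_norm_add_smul_of_not_pairHits {ε : ℝ} {q w : E} (hε : 0 ≤ ε) (hq : ε ≤ ‖q‖)
    (h : ¬ PairHits ε q w) (hdeg : ε < ‖q‖ ∨ w ≠ 0) {t : ℝ} (ht : 0 < t) : ε < ‖q + t • w‖ := by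
  have hc : 0 ≤ ‖q‖ ^ 2 - ε ^ 2 := sub_nonneg.2 (pow_le_pow_left₀ hε hq 2)
  suffices hpos : 0 < ‖q + t • w‖ ^ 2 - ε ^ 2 by
    have : ε ^ 2 < ‖q + t • w‖ ^ 2 := by linarith
    exact lt_of_pow_lt_pow_left₀ 2 (norm_nonneg _) this
  rw [norm_add_smul_sq_sub]
  by_cases hb : ⟪q, w⟫_ℝ < 0
  · -- then disc < 0, and w ≠ 0
    have hd : pairDisc ε q w < 0 := by
      by_contra hd; exact h ⟨hb, not_lt.1 hd⟩
    have ha : 0 < ‖w‖ ^ 2 := by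
      refine pow_pos (norm_pos_iff.2 ?_) 2
      rintro rfl; simp at hb
    unfold pairDisc at hd
    rw [alg_square _ _ _ _ ha.ne']
    have h3 : 0 < (‖w‖ ^ 2 * (‖q‖ ^ 2 - ε ^ 2) - ⟪q, w⟫_ℝ ^ 2) / ‖w‖ ^ 2 :=
      div_pos (by linarith) ha
    positivity
  · rw [not_lt] at hb
    rcases hdeg with hq' | hw
    · have hc' : 0 < ‖q‖ ^ 2 - ε ^ 2 := sub_pos.2 (pow_lt_pow_left₀ hq' hε two_ne_zero)
      positivity
    · have ha : 0 < ‖w‖ ^ 2 := pow_pos (norm_pos_iff.2 hw) 2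
      positivity

/-- Hitting is stable under free flight before the hitting time. [folklore] -/
theorem PairHits.add_smul {ε : ℝ} {q w : E} (h : PairHits ε q w) {s : ℝ}
    (hs : s < pairHitTime ε q w) : PairHits ε (q + s • w) w := by
  refine ⟨?_, by simpa using h.2⟩
  have ha : 0 < ‖w‖ ^ 2 := pow_pos h.norm_pos 2
  rw [inner_add_smul_self]
  have hs0 := Real.sqrt_nonneg (pairDisc ε q w)
  have : s * ‖w‖ ^ 2 < -⟪q, w⟫_ℝ - Real.sqrt (pairDisc ε q w) := by
    rw [pairHitTime] at hs
    exact (lt_div_iff₀ ha).1 hs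
  linarith

/-- The hitting time vanishes exactly at contact. [folklore] -/
theorem pairHitTime_eq_zero_iff {ε : ℝ} {q w : E} (hε : 0 ≤ ε) (h : PairHits ε q w) :
    pairHitTime ε q w = 0 ↔ ‖q‖ = ε := by
  constructor
  · intro h0
    have := norm_add_pairHitTime_smul hε h
    simpa [h0] using this
  · intro hqe
    have hd : pairDisc ε q w = ⟪q, w⟫_ℝ ^ 2 := by simp [pairDisc, hqe]
    rw [pairHitTime, hd, Real.sqrt_sq_eq_abs, abs_of_neg h.1]
    simp

/-- Strictly outside the ball the hitting time is positive. [folklore] -/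
theorem pairHitTime_pos {ε : ℝ} {q w : E} (hε : 0 ≤ ε) (hq : ε < ‖q‖) (h : PairHits ε q w) :
    0 < pairHitTime ε q w :=
  lt_of_le_of_ne (pairHitTime_nonneg hε hq.le h.1)
    (fun h0 => hq.ne' ((pairHitTime_eq_zero_iff hε h).1 h0.symm))

end Pair


/-! ## Linear algebra: shears and the velocity reflection -/

section Shear

variable {E F : Type*} [NormedAddCommGroup E] [NormedSpace ℝ E] [NormedAddCommGroup F]
  [NormedSpace ℝ F]

/-- Determinant of a composition of continuous linear endomorphisms. [folklore] -/
theorem det_comp' (f g : E →L[ℝ] E) : (f.comp g).det = f.det * g.det := by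
  rw [ContinuousLinearMap.det, ContinuousLinearMap.toLinearMap_comp, LinearMap.det_comp]

/-- The identity has determinant one. [folklore] -/
theorem det_id' : (ContinuousLinearMap.id ℝ E).det = 1 := by
  rw [ContinuousLinearMap.det, ContinuousLinearMap.coe_id, LinearMap.det_id]

/-- The upper shear `(a, u) ↦ (a + T u, u)` on `E × F` (a block-unipotent map). [folklore] -/
def upperShear (T : F →L[ℝ] E) : E × F →L[ℝ] E × F :=
  (ContinuousLinearMap.fst ℝ E F + T.comp (ContinuousLinearMap.snd ℝ E F)).prod
    (ContinuousLinearMap.snd ℝ E F)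

/-- The lower shear `(a, u) ↦ (a, u + C a)` on `E × F`. [folklore] -/
def lowerShear (C : E →L[ℝ] F) : E × F →L[ℝ] E × F :=
  (ContinuousLinearMap.fst ℝ E F).prod
    (ContinuousLinearMap.snd ℝ E F + C.comp (ContinuousLinearMap.fst ℝ E F))

/-- Unfolding lemma. [folklore] -/
@[simp] theorem upperShear_apply (T : F →L[ℝ] E) (z : E × F) :
    upperShear T z = (z.1 + T z.2, z.2) := rfl

/-- Unfolding lemma. [folklore] -/
@[simp] theorem lowerShear_apply (C : E →L[ℝ] F) (z : E × F) :
    lowerShear C z = (z.1, z.2 + C z.1) := rfl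

/-- `U_T ∘ U_{-T} = id`. [folklore] -/
theorem upperShear_comp_neg (T : F →L[ℝ] E) :
    (upperShear T).comp (upperShear (-T)) = ContinuousLinearMap.id ℝ (E × F) := by
  refine ContinuousLinearMap.ext fun z => ?_
  simp

/-- `U_{T/2} ∘ U_{T/2} = U_T`. [folklore] -/
theorem upperShear_half_comp_half (T : F →L[ℝ] E) :
    (upperShear ((2⁻¹ : ℝ) • T)).comp (upperShear ((2⁻¹ : ℝ) • T)) = upperShear T := by
  refine ContinuousLinearMap.ext fun z => ?_
  simp only [ContinuousLinearMap.coe_comp, Function.comp_apply, upperShear_apply,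
    FunLike.coe_smul, Pi.smul_apply, Prod.mk.injEq, and_true]
  rw [add_assoc, ← two_smul ℝ ((2⁻¹ : ℝ) • T z.2), smul_smul]
  norm_num

/-- `U_T` is conjugate to `U_{-T}` by `id × (-id)`. [folklore] -/
theorem upperShear_conj_neg (T : F →L[ℝ] E) :
    ((ContinuousLinearMap.id ℝ E).prodMap (-ContinuousLinearMap.id ℝ F)).comp
      ((upperShear T).comp ((ContinuousLinearMap.id ℝ E).prodMap (-ContinuousLinearMap.id ℝ F)))
      = upperShear (-T) := by
  refine ContinuousLinearMap.ext fun z => ?_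
  simp

/-- An upper shear has determinant one (proved without matrices: `det U_T · det U_{-T} = 1`,
`det U_{-T} = det U_T` by conjugation, and `det U_T = (det U_{T/2})² ≥ 0`). [folklore] -/
theorem det_upperShear (T : F →L[ℝ] E) : (upperShear T).det = 1 := by
  -- x := det U_T satisfies x * det U_{-T} = 1, det U_{-T} = x, and x = (det U_{T/2})² ≥ 0.
  have hmul : ∀ S : F →L[ℝ] E, (upperShear S).det * (upperShear (-S)).det = 1 := by
    intro S
    have := congrArg ContinuousLinearMap.det (upperShear_comp_neg S)
    rwa [det_comp', det_id'] at this
  have hconj : (upperShear (-T)).det = (upperShear T).det := by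
    have := congrArg ContinuousLinearMap.det (upperShear_conj_neg T)
    rw [det_comp', det_comp'] at this
    rw [← this]
    set d := ((ContinuousLinearMap.id ℝ E).prodMap (-ContinuousLinearMap.id ℝ F)).det
    have hd : d * d = 1 := by
      have : ((ContinuousLinearMap.id ℝ E).prodMap (-ContinuousLinearMap.id ℝ F)).comp
          ((ContinuousLinearMap.id ℝ E).prodMap (-ContinuousLinearMap.id ℝ F))
          = ContinuousLinearMap.id ℝ (E × F) := by
        refine ContinuousLinearMap.ext fun z => ?_
        obtain ⟨a, u⟩ := z
        simp
      have := congrArg ContinuousLinearMap.det this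
      rwa [det_comp', det_id'] at this
    calc d * ((upperShear T).det * d) = d * d * (upperShear T).det := by ring
      _ = (upperShear T).det := by rw [hd, one_mul]
  have hsq : (upperShear T).det = (upperShear ((2⁻¹ : ℝ) • T)).det ^ 2 := by
    have := congrArg ContinuousLinearMap.det (upperShear_half_comp_half T)
    rw [det_comp'] at this
    rw [← this, sq]
  have h1 : (upperShear T).det * (upperShear T).det = 1 := by
    have := hmul T; rwa [hconj] at this
  have h0 : 0 ≤ (upperShear T).det := by rw [hsq]; positivity
  nlinarith

/-- A lower shear has determinant one (conjugate to an upper shear by the swap). [folklore] -/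
theorem det_lowerShear (C : E →L[ℝ] F) : (lowerShear C).det = 1 := by
  -- conjugate to an upper shear by the swap
  have h : (lowerShear C : E × F →ₗ[ℝ] E × F) =
      (LinearEquiv.prodComm ℝ F E : (F × E) →ₗ[ℝ] (E × F)) ∘ₗ
        (upperShear C : (F × E) →ₗ[ℝ] (F × E)) ∘ₗ
          ((LinearEquiv.prodComm ℝ F E).symm : (E × F) →ₗ[ℝ] (F × E)) := by
    refine LinearMap.ext fun z => ?_
    simp
  rw [ContinuousLinearMap.det, h, LinearMap.det_conj]
  exact det_upperShear C

/-- Determinant of a block-diagonal continuous linear map. [folklore] -/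
theorem prodMap_det [FiniteDimensional ℝ E] [FiniteDimensional ℝ F] (f : E →L[ℝ] E)
    (g : F →L[ℝ] F) : (f.prodMap g).det = f.det * g.det := by
  rw [ContinuousLinearMap.det, ContinuousLinearMap.coe_prodMap, LinearMap.det_prodMap]

end Shear

section Reflect

variable {E : Type*} [NormedAddCommGroup E] [InnerProductSpace ℝ E]

/-- The reflection of relative velocities at contact, `w ↦ w - (2 ⟪n, w⟫ / ε²) n`, as a
continuous linear map; for `‖n‖ = ε` this is the orthogonal reflection in `nᗮ`, i.e. the map
`v_i - v_j ↦ v_i' - v_j'` of the elastic collision law (GST 2013 (1.1.3); CIP 1994 (2.1.6)). [folklore] -/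
def reflN (ε : ℝ) (n : E) : E →L[ℝ] E :=
  ContinuousLinearMap.id ℝ E - (2 / ε ^ 2) • (innerSL ℝ n).smulRight n

/-- Unfolding lemma. [folklore] -/
@[simp] theorem reflN_apply (ε : ℝ) (n w : E) :
    reflN ε n w = w - (2 / ε ^ 2 * ⟪n, w⟫_ℝ) • n := by
  simp [reflN, smul_smul]

/-- The reflection reverses the normal component: `⟪n, R_n w⟫ = -⟪n, w⟫`. [folklore] -/
theorem inner_reflN {ε : ℝ} {n : E} (hn : ‖n‖ = ε) (hε : ε ≠ 0) (w : E) :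
    ⟪n, reflN ε n w⟫_ℝ = -⟪n, w⟫_ℝ := by
  rw [reflN_apply, inner_sub_right, real_inner_smul_right, real_inner_self_eq_norm_sq, hn]
  field_simp
  ring

/-- The reflection is an involution. [folklore] -/
theorem reflN_reflN {ε : ℝ} {n : E} (hn : ‖n‖ = ε) (hε : ε ≠ 0) (w : E) :
    reflN ε n (reflN ε n w) = w := by
  rw [reflN_apply, inner_reflN hn hε, reflN_apply]
  have : 2 / ε ^ 2 * -⟪n, w⟫_ℝ = -(2 / ε ^ 2 * ⟪n, w⟫_ℝ) := by ring
  rw [this, neg_smul, sub_neg_eq_add, sub_add_cancel]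

/-- The reflection is an involution (as continuous linear maps). [folklore] -/
theorem reflN_comp_reflN {ε : ℝ} {n : E} (hn : ‖n‖ = ε) (hε : ε ≠ 0) :
    (reflN ε n).comp (reflN ε n) = ContinuousLinearMap.id ℝ E := by
  refine ContinuousLinearMap.ext fun w => ?_
  simp only [ContinuousLinearMap.coe_comp, Function.comp_apply,
    ContinuousLinearMap.coe_id', id_eq]
  exact reflN_reflN hn hε w

/-- The reflection is isometric (conservation of kinetic energy in the relative motion). [folklore] -/
theorem norm_reflN {ε : ℝ} {n : E} (hn : ‖n‖ = ε) (hε : ε ≠ 0) (w : E) :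
    ‖reflN ε n w‖ = ‖w‖ := by
  have h : ‖reflN ε n w‖ ^ 2 = ‖w‖ ^ 2 := by
    rw [reflN_apply, norm_sub_sq_real, real_inner_smul_right, norm_smul, mul_pow,
      Real.norm_eq_abs, sq_abs, hn, real_inner_comm]
    field_simp
    ring
  exact (sq_eq_sq₀ (norm_nonneg _) (norm_nonneg _)).1 h

/-- `(det R_n)² = 1`. [folklore] -/
theorem det_reflN_sq [FiniteDimensional ℝ E] {ε : ℝ} {n : E} (hn : ‖n‖ = ε) (hε : ε ≠ 0) :
    (reflN ε n).det * (reflN ε n).det = 1 := by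
  have := congrArg ContinuousLinearMap.det (reflN_comp_reflN hn hε)
  rwa [det_comp', det_id'] at this

end Reflect

/-! ## The exterior-ball billiard: one collision of the relative motion -/

section Billiard

variable {E : Type*} [NormedAddCommGroup E] [InnerProductSpace ℝ E]

/-- The open set of relative configurations `(q, w)` strictly outside the ball, approaching, and
hitting non-grazingly (the complement — grazing `disc = 0` — is the pathological set of GST 2013
§4.1). [folklore] -/
def billiardGood (ε : ℝ) : Set (E × E) :=
  {z | ε < ‖z.1‖ ∧ ⟪z.1, z.2⟫_ℝ < 0 ∧ 0 < pairDisc ε z.1 z.2}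

/-- The good set is open. [folklore] -/
theorem isOpen_billiardGood (ε : ℝ) : IsOpen (billiardGood ε : Set (E × E)) := by
  have h1 : Continuous fun z : E × E => ‖z.1‖ := continuous_fst.norm
  have h2 : Continuous fun z : E × E => ⟪z.1, z.2⟫_ℝ := continuous_fst.inner continuous_snd
  have h3 : Continuous fun z : E × E => pairDisc ε z.1 z.2 := by
    unfold pairDisc
    exact (h2.pow 2).sub ((continuous_snd.norm.pow 2).mul ((h1.pow 2).sub continuous_const))
  exact (isOpen_lt continuous_const h1).inter
    ((isOpen_lt h2 continuous_const).inter (isOpen_lt continuous_const h3))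

variable {ε : ℝ}

/-- On the good set the pair hits. [folklore] -/
theorem PairHits.of_mem_billiardGood {z : E × E} (hz : z ∈ billiardGood ε) :
    PairHits ε z.1 z.2 :=
  ⟨hz.2.1, hz.2.2.le⟩

/-- The hit point `n(z) = q + τ(z) w` of the relative motion (separation vector at contact). [folklore] -/
def hitPoint (ε : ℝ) (z : E × E) : E := z.1 + pairHitTime ε z.1 z.2 • z.2

/-- The post-collisional relative velocity `w' = R_{n(z)} w` (GST 2013 (1.1.3)). [folklore] -/
def hitVel (ε : ℝ) (z : E × E) : E := reflN ε (hitPoint ε z) z.2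

/-- The billiard collision map `g = S_{-τ} ∘ C ∘ S_τ` of the relative two-body motion:
`(q, w) ↦ (n - τ w', w')`. Composed with free flight `S_δ` (`δ ≥ τ`) it is the relative
hard-sphere dynamics over a time window containing exactly one collision (CIP 1994 §4.2, App. 4.A:
the map `T = R⁻¹ ∘ φ_a` in the special flow representation). [cite: CercignaniIllnerPulvirenti1994, §4.2 pp.64–65 and App. 4.A pp.107–111] -/
def billiardMap (ε : ℝ) (z : E × E) : E × E :=
  (hitPoint ε z - pairHitTime ε z.1 z.2 • hitVel ε z, hitVel ε z)

/-- The post-collisional relative velocity, explicitly: `w' = w - (2 ⟪n, w⟫ / ε²) n`. [folklore] -/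
theorem hitVel_eq (ε : ℝ) (z : E × E) :
    hitVel ε z = z.2 - (2 / ε ^ 2 * ⟪hitPoint ε z, z.2⟫_ℝ) • hitPoint ε z := by
  rw [hitVel, reflN_apply]

/-- The hit point lies on the sphere of radius `ε`. [folklore] -/
theorem norm_hitPoint (hε : 0 ≤ ε) {z : E × E} (hz : z ∈ billiardGood ε) :
    ‖hitPoint ε z‖ = ε :=
  norm_add_pairHitTime_smul hε (PairHits.of_mem_billiardGood hz)

/-- `⟪n, w⟫ = -√disc` at the hit point. [folklore] -/
theorem inner_hitPoint {z : E × E} (hz : z ∈ billiardGood ε) :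
    ⟪hitPoint ε z, z.2⟫_ℝ = -Real.sqrt (pairDisc ε z.1 z.2) :=
  inner_add_pairHitTime_smul (PairHits.of_mem_billiardGood hz)

/-- On the good set the collision is non-grazing: `⟪n, w⟫ < 0`. [folklore] -/
theorem inner_hitPoint_neg {z : E × E} (hz : z ∈ billiardGood ε) : ⟪hitPoint ε z, z.2⟫_ℝ < 0 := by
  rw [inner_hitPoint hz]
  exact neg_neg_of_pos (Real.sqrt_pos.2 hz.2.2)

/-- After the collision the pair is outgoing (`J` takes incoming into outgoing configurations,
CIP 1994 §4.2). [folklore] -/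
theorem inner_hitPoint_hitVel (hε : 0 < ε) {z : E × E} (hz : z ∈ billiardGood ε) :
    0 < ⟪hitPoint ε z, hitVel ε z⟫_ℝ := by
  rw [hitVel, inner_reflN (norm_hitPoint hε.le hz) hε.ne']
  exact neg_pos.2 (inner_hitPoint_neg hz)

/-! ### Differentiability of the hitting time and implicit differentiation -/

/-- The hitting time is differentiable on the good set (explicit formula with `√disc`, `disc > 0`). [folklore] -/
theorem differentiableAt_pairHitTime {z : E × E} (hz : z ∈ billiardGood ε) :
    DifferentiableAt ℝ (fun z : E × E => pairHitTime ε z.1 z.2) z := by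
  have hD : ⟪z.1, z.2⟫_ℝ ^ 2 - ‖z.2‖ ^ 2 * (‖z.1‖ ^ 2 - ε ^ 2) ≠ 0 := hz.2.2.ne'
  have ha : ‖z.2‖ ^ 2 ≠ 0 := (pow_pos (PairHits.of_mem_billiardGood hz).norm_pos 2).ne'
  have hb : DifferentiableAt ℝ (fun z : E × E => ⟪z.1, z.2⟫_ℝ) z :=
    differentiableAt_fst.inner ℝ differentiableAt_snd
  have hq : DifferentiableAt ℝ (fun z : E × E => ‖z.1‖ ^ 2) z := differentiableAt_fst.norm_sq ℝ
  have hw : DifferentiableAt ℝ (fun z : E × E => ‖z.2‖ ^ 2) z := differentiableAt_snd.norm_sq ℝ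
  have hnum : DifferentiableAt ℝ (fun z : E × E =>
      -⟪z.1, z.2⟫_ℝ - Real.sqrt (⟪z.1, z.2⟫_ℝ ^ 2 - ‖z.2‖ ^ 2 * (‖z.1‖ ^ 2 - ε ^ 2))) z := by
    refine hb.neg.sub ?_
    refine DifferentiableAt.sqrt ?_ hD
    exact (hb.pow 2).sub (hw.mul (hq.sub (differentiableAt_const _)))
  unfold pairHitTime pairDisc
  simp only [div_eq_mul_inv]
  exact hnum.mul (hw.inv ha)

/-- The derivative of the hit point computed naively from a derivative `τ'` of the hitting
time. [folklore] -/
theorem hasFDerivAt_hitPoint_aux {z : E × E} (hz : z ∈ billiardGood ε) :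
    HasFDerivAt (hitPoint ε)
      (ContinuousLinearMap.fst ℝ E E + (pairHitTime ε z.1 z.2 • ContinuousLinearMap.snd ℝ E E +
        (fderiv ℝ (fun z : E × E => pairHitTime ε z.1 z.2) z).smulRight z.2)) z :=
  hasFDerivAt_fst.add ((differentiableAt_pairHitTime hz).hasFDerivAt.fun_smul hasFDerivAt_snd)

/-- Implicit differentiation of `‖q + τ w‖ = ε`: `τ'(h) ⟪n, w⟫ = -⟪n, h₁ + τ h₂⟫`. [folklore] -/
theorem fderiv_pairHitTime_mul_inner (hε : 0 < ε) {z : E × E} (hz : z ∈ billiardGood ε)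
    (h : E × E) :
    fderiv ℝ (fun z : E × E => pairHitTime ε z.1 z.2) z h * ⟪hitPoint ε z, z.2⟫_ℝ =
      -⟪hitPoint ε z, h.1 + pairHitTime ε z.1 z.2 • h.2⟫_ℝ := by
  have hN := hasFDerivAt_hitPoint_aux hz
  have hΦ := hN.norm_sq
  have hconst : (fun y : E × E => ‖hitPoint ε y‖ ^ 2) =ᶠ[𝓝 z] fun _ => ε ^ 2 := by
    filter_upwards [(isOpen_billiardGood ε).mem_nhds hz] with y hy
    rw [norm_hitPoint hε.le hy]
  have hΦ0 : HasFDerivAt (fun y : E × E => ‖hitPoint ε y‖ ^ 2) (0 : E × E →L[ℝ] ℝ) z :=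
    (hasFDerivAt_const (ε ^ 2) z).congr_of_eventuallyEq hconst
  have heq := congrArg (fun L : E × E →L[ℝ] ℝ => L h) (hΦ.unique hΦ0)
  simp only [FunLike.coe_smul, Pi.smul_apply, ContinuousLinearMap.coe_comp,
    Function.comp_apply, add_apply, ContinuousLinearMap.coe_fst',
    ContinuousLinearMap.coe_snd', ContinuousLinearMap.smulRight_apply, innerSL_apply_apply,
    zero_apply] at heq
  rw [inner_add_right, inner_add_right, inner_smul_right, inner_smul_right] at heq
  have heq' : 2 * ⟪hitPoint ε z, h.1⟫_ℝ + (2 * (pairHitTime ε z.1 z.2 * ⟪hitPoint ε z, h.2⟫_ℝ) +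
      2 * (fderiv ℝ (fun z : E × E => pairHitTime ε z.1 z.2) z h * ⟪hitPoint ε z, z.2⟫_ℝ)) = 0 := by
    simpa using heq
  rw [inner_add_right, inner_smul_right]
  linarith

/-! ### The derivative of the billiard map -/

/-- `A_τ (h₁, h₂) = h₁ + τ h₂`, the position part of the derivative of free flight. [folklore] -/
def dFree (τ : ℝ) : E × E →L[ℝ] E :=
  ContinuousLinearMap.fst ℝ E E + τ • ContinuousLinearMap.snd ℝ E E

/-- `P a = a - (⟪n, a⟫ / ⟪n, w⟫) w`, the projection onto `nᗮ` along `w`. [folklore] -/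
def dProj (ε : ℝ) (z : E × E) : E →L[ℝ] E :=
  ContinuousLinearMap.id ℝ E -
    (⟪hitPoint ε z, z.2⟫_ℝ)⁻¹ • (innerSL ℝ (hitPoint ε z)).smulRight z.2

/-- The derivative of the hit point: `dn = P ∘ A_τ`. [folklore] -/
def dHitPoint (ε : ℝ) (z : E × E) : E × E →L[ℝ] E :=
  (dProj ε z).comp (dFree (pairHitTime ε z.1 z.2))

/-- `K m = -(2/ε²) (⟪w, m⟫ n + ⟪n, w⟫ m)`, the derivative of `n ↦ R_n w` in `n`. [folklore] -/
def dK (ε : ℝ) (z : E × E) : E →L[ℝ] E :=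
  -(2 / ε ^ 2) • ((innerSL ℝ z.2).smulRight (hitPoint ε z) +
    ⟪hitPoint ε z, z.2⟫_ℝ • ContinuousLinearMap.id ℝ E)

/-- The derivative of the post-collisional velocity: `dw' = R_n h₂ + K dn`. [folklore] -/
def dHitVel (ε : ℝ) (z : E × E) : E × E →L[ℝ] E :=
  (reflN ε (hitPoint ε z)).comp (ContinuousLinearMap.snd ℝ E E) + (dK ε z).comp (dHitPoint ε z)

/-- The derivative of the billiard map: `(R_n A_τ h - τ dw' h, dw' h)`. [folklore] -/
def dBilliard (ε : ℝ) (z : E × E) : E × E →L[ℝ] E × E :=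
  ((reflN ε (hitPoint ε z)).comp (dFree (pairHitTime ε z.1 z.2)) -
    pairHitTime ε z.1 z.2 • dHitVel ε z).prod (dHitVel ε z)

/-- Unfolding lemma. [folklore] -/
@[simp] theorem dFree_apply (τ : ℝ) (h : E × E) : dFree τ h = h.1 + τ • h.2 := rfl

/-- Unfolding lemma. [folklore] -/
theorem dProj_apply (ε : ℝ) (z : E × E) (a : E) :
    dProj ε z a = a - ((⟪hitPoint ε z, z.2⟫_ℝ)⁻¹ * ⟪hitPoint ε z, a⟫_ℝ) • z.2 := by
  simp [dProj, smul_smul]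

/-- Unfolding lemma. [folklore] -/
theorem dHitPoint_apply (ε : ℝ) (z : E × E) (h : E × E) :
    dHitPoint ε z h = dProj ε z (h.1 + pairHitTime ε z.1 z.2 • h.2) := rfl

/-- Unfolding lemma. [folklore] -/
theorem dK_apply (ε : ℝ) (z : E × E) (m : E) :
    dK ε z m = -(2 / ε ^ 2) • (⟪z.2, m⟫_ℝ • hitPoint ε z + ⟪hitPoint ε z, z.2⟫_ℝ • m) := by
  simp [dK]

/-- Unfolding lemma. [folklore] -/
theorem dHitVel_apply (ε : ℝ) (z : E × E) (h : E × E) :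
    dHitVel ε z h = reflN ε (hitPoint ε z) h.2 + dK ε z (dHitPoint ε z h) := rfl

/-- Unfolding lemma. [folklore] -/
theorem dBilliard_apply (ε : ℝ) (z : E × E) (h : E × E) :
    dBilliard ε z h =
      (reflN ε (hitPoint ε z) (h.1 + pairHitTime ε z.1 z.2 • h.2) -
        pairHitTime ε z.1 z.2 • dHitVel ε z h, dHitVel ε z h) := rfl

/-- The hit point is differentiable with derivative `P ∘ A_τ` (implicit differentiation). [folklore] -/
theorem hasFDerivAt_hitPoint (hε : 0 < ε) {z : E × E} (hz : z ∈ billiardGood ε) :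
    HasFDerivAt (hitPoint ε) (dHitPoint ε z) z := by
  refine (hasFDerivAt_hitPoint_aux hz).congr_fderiv (ContinuousLinearMap.ext fun h => ?_)
  have hν : ⟪hitPoint ε z, z.2⟫_ℝ ≠ 0 := (inner_hitPoint_neg hz).ne
  have key := fderiv_pairHitTime_mul_inner hε hz h
  set τ' := fderiv ℝ (fun z : E × E => pairHitTime ε z.1 z.2) z h with hτ'
  have hτ'' : τ' = -((⟪hitPoint ε z, z.2⟫_ℝ)⁻¹ *
      ⟪hitPoint ε z, h.1 + pairHitTime ε z.1 z.2 • h.2⟫_ℝ) := by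
    field_simp
    linarith
  rw [dHitPoint_apply, dProj_apply]
  simp only [add_apply, ContinuousLinearMap.coe_fst',
    FunLike.coe_smul, Pi.smul_apply, ContinuousLinearMap.coe_snd',
    ContinuousLinearMap.smulRight_apply]
  rw [← hτ', hτ'', neg_smul, sub_eq_add_neg, add_assoc]

/-- The post-collisional velocity is differentiable with derivative `R_n h₂ + K dn`. [folklore] -/
theorem hasFDerivAt_hitVel (hε : 0 < ε) {z : E × E} (hz : z ∈ billiardGood ε) :
    HasFDerivAt (hitVel ε) (dHitVel ε z) z := by
  have hfun : hitVel ε = fun y : E × E =>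
      y.2 - (2 / ε ^ 2 * ⟪hitPoint ε y, y.2⟫_ℝ) • hitPoint ε y := funext (hitVel_eq ε)
  rw [hfun]
  have hn := hasFDerivAt_hitPoint hε hz
  have hs : HasFDerivAt (fun y : E × E => 2 / ε ^ 2 * ⟪hitPoint ε y, y.2⟫_ℝ)
      ((2 / ε ^ 2) • (fderivInnerCLM ℝ (hitPoint ε z, z.2)).comp
        ((dHitPoint ε z).prod (ContinuousLinearMap.snd ℝ E E))) z :=
    (hn.inner ℝ hasFDerivAt_snd).const_mul (2 / ε ^ 2)
  refine (hasFDerivAt_snd.sub (hs.fun_smul hn)).congr_fderiv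
    (ContinuousLinearMap.ext fun h => ?_)
  set m := dHitPoint ε z h with hm
  rw [dHitVel_apply, reflN_apply, dK_apply, ← hm]
  simp only [sub_apply, ContinuousLinearMap.coe_snd',
    add_apply, FunLike.coe_smul, Pi.smul_apply,
    ContinuousLinearMap.smulRight_apply, ContinuousLinearMap.coe_comp, Function.comp_apply,
    ContinuousLinearMap.prod_apply, fderivInnerCLM_apply, smul_eq_mul]
  rw [← hm, real_inner_comm z.2 m]
  module

/-- The billiard collision map is differentiable on the good set, with derivative `dBilliard`. [folklore] -/
theorem hasFDerivAt_billiardMap (hε : 0 < ε) {z : E × E} (hz : z ∈ billiardGood ε) :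
    HasFDerivAt (billiardMap ε) (dBilliard ε z) z := by
  have hn := hasFDerivAt_hitPoint hε hz
  have hv := hasFDerivAt_hitVel hε hz
  have hτ := (differentiableAt_pairHitTime hz).hasFDerivAt (f := fun z : E × E =>
    pairHitTime ε z.1 z.2)
  have h1 : HasFDerivAt (fun y : E × E => hitPoint ε y - pairHitTime ε y.1 y.2 • hitVel ε y)
      ((reflN ε (hitPoint ε z)).comp (dFree (pairHitTime ε z.1 z.2)) -
        pairHitTime ε z.1 z.2 • dHitVel ε z) z := by
    refine (hn.sub (hτ.fun_smul hv)).congr_fderiv (ContinuousLinearMap.ext fun h => ?_)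
    have hν : ⟪hitPoint ε z, z.2⟫_ℝ ≠ 0 := (inner_hitPoint_neg hz).ne
    have key := fderiv_pairHitTime_mul_inner hε hz h
    set τ' := fderiv ℝ (fun z : E × E => pairHitTime ε z.1 z.2) z h with hτ'
    have hτ'' : τ' = -((⟪hitPoint ε z, z.2⟫_ℝ)⁻¹ *
        ⟪hitPoint ε z, h.1 + pairHitTime ε z.1 z.2 • h.2⟫_ℝ) := by
      field_simp
      linarith
    simp only [sub_apply, add_apply,
      FunLike.coe_smul, Pi.smul_apply, ContinuousLinearMap.smulRight_apply,
      ContinuousLinearMap.coe_comp, Function.comp_apply, dFree_apply]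
    rw [← hτ', dHitPoint_apply, dProj_apply, hitVel_eq, reflN_apply, hτ'']
    set ν := ⟪hitPoint ε z, z.2⟫_ℝ
    set c := ⟪hitPoint ε z, h.1 + pairHitTime ε z.1 z.2 • h.2⟫_ℝ
    have h1 : ν⁻¹ * c * (2 / ε ^ 2 * ν) = 2 / ε ^ 2 * c := by field_simp
    linear_combination (norm := module) (-h1) • hitPoint ε z
  exact h1.prodMk hv

/-! ### The Jacobian determinant is `±1` -/

/-- Factorisation of the derivative into shears and reflections:
`dg = U_{-τ} ∘ (R_n × id) ∘ L_{K P} ∘ (id × R_n) ∘ U_τ`. [folklore] -/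
theorem dBilliard_eq (ε : ℝ) (z : E × E) :
    dBilliard ε z =
      (upperShear (-(pairHitTime ε z.1 z.2 • ContinuousLinearMap.id ℝ E))).comp
        (((reflN ε (hitPoint ε z)).prodMap (ContinuousLinearMap.id ℝ E)).comp
          ((lowerShear ((dK ε z).comp (dProj ε z))).comp
            (((ContinuousLinearMap.id ℝ E).prodMap (reflN ε (hitPoint ε z))).comp
              (upperShear (pairHitTime ε z.1 z.2 • ContinuousLinearMap.id ℝ E))))) := by
  refine ContinuousLinearMap.ext fun h => ?_
  rw [dBilliard_apply, dHitVel_apply, dHitPoint_apply]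
  simp [sub_eq_add_neg]

/-- **The Jacobian determinant of the billiard collision map is `1`**: the derivative factors as
(shear) ∘ (`R_n × id`) ∘ (shear) ∘ (`id × R_n`) ∘ (shear), and `(det R_n)² = 1` (CIP 1994 §4.2 Problem 1:
`|det J| = 1`). [cite: CercignaniIllnerPulvirenti1994, §4.2 Problem 1 (p.68)] -/
theorem det_dBilliard [FiniteDimensional ℝ E] (hε : 0 < ε) {z : E × E}
    (hz : z ∈ billiardGood ε) : (dBilliard ε z).det = 1 := by
  rw [dBilliard_eq, det_comp', det_comp', det_comp', det_comp', det_upperShear, det_upperShear,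
    det_lowerShear, prodMap_det, prodMap_det, det_id']
  have := det_reflN_sq (norm_hitPoint hε.le hz) hε.ne'
  linear_combination this

/-! ### Injectivity -/

/-- The billiard collision map is injective on the good set (the outgoing data `(n, w')` determine the
collision: a line leaves the sphere outgoing at exactly one point). [folklore] -/
theorem billiardMap_injOn (hε : 0 < ε) : InjOn (billiardMap ε) (billiardGood ε : Set (E × E)) := by
  intro z₁ h₁ z₂ h₂ heq
  simp only [billiardMap, Prod.mk.injEq] at heq
  obtain ⟨hq, hu⟩ := heq
  set n₁ := hitPoint ε z₁
  set n₂ := hitPoint ε z₂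
  set τ₁ := pairHitTime ε z₁.1 z₁.2
  set τ₂ := pairHitTime ε z₂.1 z₂.2
  set u := hitVel ε z₂
  have hn₁ : ‖n₁‖ = ε := norm_hitPoint hε.le h₁
  have hn₂ : ‖n₂‖ = ε := norm_hitPoint hε.le h₂
  have hp₁ : 0 < ⟪n₁, u⟫_ℝ := by rw [← hu]; exact inner_hitPoint_hitVel hε h₁
  have hp₂ : 0 < ⟪n₂, u⟫_ℝ := inner_hitPoint_hitVel hε h₂
  rw [hu] at hq
  -- n₁ = n₂ + (τ₁ - τ₂) • u
  have e1 : n₁ = n₂ + (τ₁ - τ₂) • u := by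
    rw [sub_smul]
    have := hq
    -- n₁ - τ₁ u = n₂ - τ₂ u
    calc n₁ = (n₁ - τ₁ • u) + τ₁ • u := by abel
      _ = (n₂ - τ₂ • u) + τ₁ • u := by rw [hq]
      _ = n₂ + (τ₁ • u - τ₂ • u) := by abel
  have e2 : n₂ = n₁ + (τ₂ - τ₁) • u := by rw [e1]; module
  have hsq1 := norm_add_smul_sq n₂ u (τ₁ - τ₂)
  have hsq2 := norm_add_smul_sq n₁ u (τ₂ - τ₁)
  rw [← e1, hn₁, hn₂] at hsq1
  rw [← e2, hn₁, hn₂] at hsq2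
  have hτ : τ₁ = τ₂ := by
    have hu0 : 0 ≤ (τ₁ - τ₂) ^ 2 * ‖u‖ ^ 2 := by positivity
    nlinarith
  have hn : n₁ = n₂ := by rw [e1, hτ, sub_self, zero_smul, add_zero]
  -- recover w and q
  have hw : z₁.2 = z₂.2 := by
    have h1' : z₁.2 = reflN ε n₁ (hitVel ε z₁) := (reflN_reflN hn₁ hε.ne' _).symm
    have h2' : z₂.2 = reflN ε n₂ u := (reflN_reflN hn₂ hε.ne' _).symm
    rw [h1', h2', hu, hn]
  have hq' : z₁.1 = z₂.1 := by
    have h1' : z₁.1 = n₁ - τ₁ • z₁.2 := by simp [n₁, τ₁, hitPoint]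
    have h2' : z₂.1 = n₂ - τ₂ • z₂.2 := by simp [n₂, τ₂, hitPoint]
    rw [h1', h2', hn, hτ, hw]
  exact Prod.ext hq' hw

/-! ### Volume preservation (Liouville's theorem for one hard-sphere collision) -/

/-- The billiard collision map preserves Lebesgue (additive Haar) measure on the good set:
`μ (g '' s) = μ s` for measurable `s ⊆ billiardGood ε` (CIP 1994 §4.2: the collision transformation
preserves Lebesgue measure; App. 4.A: the special-flow map is measure preserving "by the Liouville
theorem"; here from the change-of-variables formula and `det dg = 1`). [cite: CercignaniIllnerPulvirenti1994, §4.2 p.65, App. 4.A pp.107–109 (Problems 1–2)] -/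
theorem addHaar_image_billiardMap [FiniteDimensional ℝ E] [MeasurableSpace E] [BorelSpace E]
    (μ : Measure (E × E)) [μ.IsAddHaarMeasure] (hε : 0 < ε) {s : Set (E × E)}
    (hs : MeasurableSet s) (hsub : s ⊆ billiardGood ε) : μ (billiardMap ε '' s) = μ s := by
  have h := lintegral_abs_det_fderiv_eq_addHaar_image μ hs
    (fun _ hx => (hasFDerivAt_billiardMap hε (hsub hx)).hasFDerivWithinAt)
    ((billiardMap_injOn hε).mono hsub)
  rw [← h]
  have : ∀ x ∈ s, ENNReal.ofReal |(dBilliard ε x).det| = 1 := fun x hx => by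
    rw [det_dBilliard hε (hsub hx)]; simp
  rw [setLIntegral_congr_fun hs this, setLIntegral_one]

/-- Measurability of the image (Lusin–Souslin, via `measurable_image_of_fderivWithin`). [folklore] -/
theorem measurableSet_image_billiardMap [FiniteDimensional ℝ E] [MeasurableSpace E]
    [BorelSpace E] (hε : 0 < ε) {s : Set (E × E)} (hs : MeasurableSet s)
    (hsub : s ⊆ billiardGood ε) : MeasurableSet (billiardMap ε '' s) :=
  measurable_image_of_fderivWithin hs
    (fun _ hx => (hasFDerivAt_billiardMap hε (hsub hx)).hasFDerivWithinAt)
    ((billiardMap_injOn hε).mono hsub)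

end Billiard

/-! ### After the collision -/

section After

variable {E : Type*} [NormedAddCommGroup E] [InnerProductSpace ℝ E] {ε : ℝ}

/-- The collision preserves the relative speed. [folklore] -/
theorem norm_hitVel (hε : 0 < ε) {z : E × E} (hz : z ∈ billiardGood ε) :
    ‖hitVel ε z‖ = ‖z.2‖ :=
  norm_reflN (norm_hitPoint hε.le hz) hε.ne' z.2

/-- The post-collisional relative velocity is nonzero. [folklore] -/
theorem hitVel_ne_zero (hε : 0 < ε) {z : E × E} (hz : z ∈ billiardGood ε) : hitVel ε z ≠ 0 := by
  rw [← norm_ne_zero_iff, norm_hitVel hε hz]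
  exact (PairHits.of_mem_billiardGood hz).norm_pos.ne'

/-- The incoming velocity is recovered from the outgoing one by the same reflection (`J² = id`,
CIP 1994 §4.2). [folklore] -/
theorem reflN_hitVel (hε : 0 < ε) {z : E × E} (hz : z ∈ billiardGood ε) :
    reflN ε (hitPoint ε z) (hitVel ε z) = z.2 :=
  reflN_reflN (norm_hitPoint hε.le hz) hε.ne' z.2

/-- After the collision the pair never touches again under free flight: `ε < ‖n + t w'‖` for
`t > 0` (two hard spheres collide at most once). [folklore] -/
theorem lt_norm_hitPoint_add_smul_hitVel (hε : 0 < ε) {z : E × E} (hz : z ∈ billiardGood ε)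
    {t : ℝ} (ht : 0 < t) : ε < ‖hitPoint ε z + t • hitVel ε z‖ := by
  refine lt_norm_add_smul_of_not_pairHits hε.le (norm_hitPoint hε.le hz).ge ?_
    (Or.inr (hitVel_ne_zero hε hz)) ht
  exact fun h => lt_asymm h.1 (inner_hitPoint_hitVel hε hz)

/-- The physical one-step map: free flight for the remaining time `δ - τ` after the collision,
`S_δ (g z) = (n + (δ - τ) w', w')`. [folklore] -/
theorem billiardMap_fst_add_smul (ε δ : ℝ) (z : E × E) :
    (billiardMap ε z).1 + δ • (billiardMap ε z).2 =
      hitPoint ε z + (δ - pairHitTime ε z.1 z.2) • hitVel ε z := by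
  simp only [billiardMap]
  module

end After

/-! ## The two-body collision in particle coordinates -/

section TwoBody

variable {E : Type*} [NormedAddCommGroup E] [InnerProductSpace ℝ E]

/-- Relative coordinates `(x₁ - x₂, v₁ - v₂)` of a pair of particles `((x₁, v₁), (x₂, v₂))`. [folklore] -/
def relOf (p : (E × E) × (E × E)) : E × E := (p.1.1 - p.2.1, p.1.2 - p.2.2)

omit [InnerProductSpace ℝ E] in
/-- Unfolding lemma. [folklore] -/
@[simp] theorem relOf_apply [NormedSpace ℝ E] (p : (E × E) × (E × E)) :
    relOf p = (p.1.1 - p.2.1, p.1.2 - p.2.2) := rfl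

/-- The (unnormalised) centre/relative coordinates `(z₁, z₂) ↦ (z₁ + z₂, z₁ - z₂)`, a continuous
linear automorphism of `(E × E) × (E × E)`. [folklore] -/
def sumDiffEquiv : ((E × E) × (E × E)) ≃L[ℝ] ((E × E) × (E × E)) :=
  ContinuousLinearEquiv.equivOfInverse
    ((ContinuousLinearMap.fst ℝ (E × E) (E × E) + ContinuousLinearMap.snd ℝ (E × E) (E × E)).prod
      (ContinuousLinearMap.fst ℝ (E × E) (E × E) - ContinuousLinearMap.snd ℝ (E × E) (E × E)))
    (((2⁻¹ : ℝ) • (ContinuousLinearMap.fst ℝ (E × E) (E × E) +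
        ContinuousLinearMap.snd ℝ (E × E) (E × E))).prod
      ((2⁻¹ : ℝ) • (ContinuousLinearMap.fst ℝ (E × E) (E × E) -
        ContinuousLinearMap.snd ℝ (E × E) (E × E))))
    (fun p => by
      ext <;> simp <;> module)
    (fun p => by
      ext <;> simp <;> module)

/-- Unfolding lemma. [folklore] -/
@[simp] theorem sumDiffEquiv_apply (p : (E × E) × (E × E)) :
    sumDiffEquiv p = (p.1 + p.2, p.1 - p.2) := rfl

/-- Unfolding lemma for the inverse: `(a, b) ↦ ((a + b)/2, (a - b)/2)`. [folklore] -/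
@[simp] theorem sumDiffEquiv_symm_apply (p : (E × E) × (E × E)) :
    sumDiffEquiv.symm p = ((2⁻¹ : ℝ) • (p.1 + p.2), (2⁻¹ : ℝ) • (p.1 - p.2)) := rfl

/-- The second component of `sumDiffEquiv` is the relative coordinate map. [folklore] -/
theorem sumDiffEquiv_apply_snd (p : (E × E) × (E × E)) : (sumDiffEquiv p).2 = relOf p := by
  simp [Prod.ext_iff]

/-- The two-body hard-sphere collision step in particle coordinates: flow freely to the collision
time `τ`, reflect the velocities of the pair, flow back by `τ`. With `n` the separation vector at
contact and `c = ⟪n, v₁ - v₂⟫ / ε²`: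
`((x₁, v₁), (x₂, v₂)) ↦ ((x₁ + τ c n, v₁ - c n), (x₂ - τ c n, v₂ + c n))` (GST 2013 (1.1.1)–(1.1.3);
CIP 1994 §4.2). [cite: CercignaniIllnerPulvirenti1994, §4.2 pp.64–65] -/
def twoBodyCollide (ε : ℝ) (p : (E × E) × (E × E)) : (E × E) × (E × E) :=
  ((p.1.1 + (pairHitTime ε (relOf p).1 (relOf p).2 * (⟪hitPoint ε (relOf p), (relOf p).2⟫_ℝ / ε ^ 2)) •
      hitPoint ε (relOf p),
    p.1.2 - (⟪hitPoint ε (relOf p), (relOf p).2⟫_ℝ / ε ^ 2) • hitPoint ε (relOf p)),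
   (p.2.1 - (pairHitTime ε (relOf p).1 (relOf p).2 * (⟪hitPoint ε (relOf p), (relOf p).2⟫_ℝ / ε ^ 2)) •
      hitPoint ε (relOf p),
    p.2.2 + (⟪hitPoint ε (relOf p), (relOf p).2⟫_ℝ / ε ^ 2) • hitPoint ε (relOf p)))

/-- The good set of two-body configurations: relative coordinates in `billiardGood ε`. [folklore] -/
def twoBodyGood (ε : ℝ) : Set ((E × E) × (E × E)) := relOf ⁻¹' billiardGood ε

/-- The two-body good set is open. [folklore] -/
theorem isOpen_twoBodyGood (ε : ℝ) : IsOpen (twoBodyGood ε : Set ((E × E) × (E × E))) :=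
  (isOpen_billiardGood ε).preimage (by unfold relOf; fun_prop)

/-- The two-body step is the billiard map of the relative motion, conjugated by the
centre/relative coordinates (the centre of mass moves freely and is restored by flowing back;
CIP 1994 App. 4.B reduces to the two-particle phase point in the same way). [folklore] -/
theorem twoBodyCollide_eq_conj (ε : ℝ) :
    (twoBodyCollide ε : (E × E) × (E × E) → (E × E) × (E × E)) =
      sumDiffEquiv.symm ∘ Prod.map id (billiardMap ε) ∘ sumDiffEquiv := by
  funext p
  simp only [Function.comp_apply, sumDiffEquiv_apply, Prod.map_apply, id_eq,
    sumDiffEquiv_symm_apply, twoBodyCollide, billiardMap, hitVel_eq]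
  have hrel : (p.1 - p.2) = relOf p := by simp [Prod.ext_iff]
  rw [hrel]
  simp only [relOf_apply, hitPoint]
  ext <;> simp only [Prod.fst_add, Prod.snd_add, Prod.fst_sub, Prod.snd_sub, Prod.smul_fst,
    Prod.smul_snd] <;> module

/-- The two-body step is injective on the good set. [folklore] -/
theorem twoBodyCollide_injOn {ε : ℝ} (hε : 0 < ε) :
    InjOn (twoBodyCollide ε) (twoBodyGood ε : Set ((E × E) × (E × E))) := by
  rw [twoBodyCollide_eq_conj]
  intro p hp p' hp' h
  have h1 : Prod.map id (billiardMap ε) (sumDiffEquiv p) =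
      Prod.map id (billiardMap ε) (sumDiffEquiv p') := sumDiffEquiv.symm.injective h
  obtain ⟨ha, hb⟩ := Prod.ext_iff.1 h1
  simp only [Prod.map_fst, Prod.map_snd, id_eq] at ha hb
  rw [sumDiffEquiv_apply_snd, sumDiffEquiv_apply_snd] at hb
  have h2 : sumDiffEquiv p = sumDiffEquiv p' := by
    refine Prod.ext ha ?_
    rw [sumDiffEquiv_apply_snd, sumDiffEquiv_apply_snd]
    exact billiardMap_injOn hε hp hp' hb
  exact sumDiffEquiv.injective h2

/-- The derivative of the two-body step. [folklore] -/
def dTwoBody (ε : ℝ) (p : (E × E) × (E × E)) : ((E × E) × (E × E)) →L[ℝ] ((E × E) × (E × E)) :=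
  ((sumDiffEquiv (E := E)).symm : ((E × E) × (E × E)) →L[ℝ] ((E × E) × (E × E))).comp
    (((ContinuousLinearMap.id ℝ (E × E)).prodMap (dBilliard ε (relOf p))).comp
      (sumDiffEquiv (E := E) : ((E × E) × (E × E)) →L[ℝ] ((E × E) × (E × E))))

/-- The two-body step is differentiable on the good set with derivative `dTwoBody`. [folklore] -/
theorem hasFDerivAt_twoBodyCollide {ε : ℝ} (hε : 0 < ε) {p : (E × E) × (E × E)}
    (hp : p ∈ twoBodyGood ε) : HasFDerivAt (twoBodyCollide ε) (dTwoBody ε p) p := by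
  rw [twoBodyCollide_eq_conj]
  refine (sumDiffEquiv (E := E)).symm.hasFDerivAt.comp p ?_
  refine HasFDerivAt.comp p ?_ (sumDiffEquiv (E := E)).hasFDerivAt
  have hg : HasFDerivAt (billiardMap ε) (dBilliard ε (relOf p)) (sumDiffEquiv p).2 := by
    rw [sumDiffEquiv_apply_snd]
    exact hasFDerivAt_billiardMap hε hp
  exact HasFDerivAt.prodMap (p := sumDiffEquiv p) (hasFDerivAt_id (𝕜 := ℝ) _) hg

/-- The Jacobian determinant of the two-body step is `1`. [folklore] -/
theorem det_dTwoBody [FiniteDimensional ℝ E] {ε : ℝ} (hε : 0 < ε) {p : (E × E) × (E × E)}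
    (hp : p ∈ twoBodyGood ε) : (dTwoBody ε p).det = 1 := by
  rw [dTwoBody, ContinuousLinearMap.det, ContinuousLinearMap.toLinearMap_comp,
    ContinuousLinearMap.toLinearMap_comp]
  have := LinearMap.det_conj
    (((ContinuousLinearMap.id ℝ (E × E)).prodMap (dBilliard ε (relOf p)) :
      ((E × E) × (E × E)) →L[ℝ] ((E × E) × (E × E))) : ((E × E) × (E × E)) →ₗ[ℝ] ((E × E) × (E × E)))
    ((sumDiffEquiv (E := E)).symm.toLinearEquiv : ((E × E) × (E × E)) ≃ₗ[ℝ] ((E × E) × (E × E)))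
  rw [ContinuousLinearEquiv.toLinearEquiv_symm, LinearEquiv.symm_symm] at this
  erw [this]
  rw [← ContinuousLinearMap.det, prodMap_det, det_id', det_dBilliard hε hp, one_mul]

/-- **Liouville's theorem for one binary hard-sphere collision** (two-body, particle
coordinates): the collision step preserves additive Haar (Lebesgue) measure on the good set
(CIP 1994 §4.2 p.65: `J` preserves Lebesgue measure; App. 4.A; GST 2013 Prop. 4.1.1 uses "the
measure is invariant by the flow"). [cite: CercignaniIllnerPulvirenti1994, §4.2 p.65 and App. 4.A pp.107–111] -/
theorem addHaar_image_twoBodyCollide [FiniteDimensional ℝ E] [MeasurableSpace E] [BorelSpace E]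
    (μ : Measure ((E × E) × (E × E))) [μ.IsAddHaarMeasure] {ε : ℝ} (hε : 0 < ε)
    {s : Set ((E × E) × (E × E))} (hs : MeasurableSet s) (hsub : s ⊆ twoBodyGood ε) :
    μ (twoBodyCollide ε '' s) = μ s := by
  have h := lintegral_abs_det_fderiv_eq_addHaar_image μ hs
    (fun _ hx => (hasFDerivAt_twoBodyCollide hε (hsub hx)).hasFDerivWithinAt)
    ((twoBodyCollide_injOn hε).mono hsub)
  rw [← h]
  have : ∀ x ∈ s, ENNReal.ofReal |(dTwoBody ε x).det| = 1 := fun x hx => by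
    rw [det_dTwoBody hε (hsub hx)]; simp
  rw [setLIntegral_congr_fun hs this, setLIntegral_one]

/-- Measurability of the image of a measurable good set under the two-body step. [folklore] -/
theorem measurableSet_image_twoBodyCollide [FiniteDimensional ℝ E] [MeasurableSpace E]
    [BorelSpace E] {ε : ℝ} (hε : 0 < ε) {s : Set ((E × E) × (E × E))} (hs : MeasurableSet s)
    (hsub : s ⊆ twoBodyGood ε) : MeasurableSet (twoBodyCollide ε '' s) :=
  measurable_image_of_fderivWithin hs
    (fun _ hx => (hasFDerivAt_twoBodyCollide hε (hsub hx)).hasFDerivWithinAt)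
    ((twoBodyCollide_injOn hε).mono hsub)

end TwoBody

end Kinetic

end

end Literature.Analysis.FluidPDE
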